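import Mathlib.Algebra.Order.BigOperators.Group.Finset
import Mathlib.Algebra.BigOperators.Group.Finset.Basic
import Mathlib.Algebra.Order.Field.Basic
import Mathlib.Data.Real.Basic
import Mathlib.Tactic.Linarith
import Mathlib.Tactic.Positivity
import Mathlib.Tactic.Ring
import HarnessLib

/-!
# One-step scheme: DOMINATION RULES for admissible rank weights (soundness half of the matching certificate)

Support file (prover prim-ineq-prove-3 gen 32; `--supports stmt-CriticalPhenomena-4575`; memo
`run/shared/lean/prim/prim-ineq-prove-3/FINDING-G32-MATCHING.md` §2).  No definitions, no named facts, no sorries, no `native_decide`.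

An *admissible weight* is a sequence `ω : ℕ → ℝ` with `0 ≤ ω`, `ω (k+1) ≤ ω k`, `ω 0 ≤ 1` and `ω k · ω (k+2) ≤ ω (k+1)²` (log-concave);
the phantom tail weights `ω_k = μ{N_R + k < t}` of `…SahiOneStepPhantomWeights` are admissible (`real_phantomTail_antitone`,
`real_phantomTail_le_one`, `real_phantomTail_logConcave`).  The fibre coefficients of the `(2′)` functional are `ℤ`-combinations of the
monomials `ω_k` and `ω_i ω_j` (memo §1); the memo's MATCHING CERTIFICATE proves such a combination nonnegative by pairing every negative unit
with a dominating positive unit.  This file proves the domination rules for all admissible weights, i.e. the soundness of those certificates: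
* `lc_exchange_step`, `lc_exchange` — the log-concave exchange `ω a · ω d ≤ ω b · ω c` for `a ≤ b ≤ c ≤ d`, `a + d = b + c` (zeros allowed);
* `mul_le_of_le_max` — rule R1: `ω i · ω j ≤ ω k` whenever `k ≤ max i j`;
* `mul_le_mul_of_dominated` — rule R2: `ω i · ω j ≤ ω k · ω l` whenever `k ≤ l`, `l ≤ j`, `k + l ≤ i + j`;
* `mul_zero_le_mul_of_add_le` — rule R4: `ω 0 · ω k ≤ ω i · ω j` whenever `i + j ≤ k`;
* `sum_le_sum_of_dominating_injection` — a negative multiset injectively dominated by a nonnegative one has the smaller sum.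
-/

namespace Summit.CriticalPhenomena.PercolationContinuityZ3.Theorems

namespace SahiOneStep

open Finset

/-! ## The log-concave exchange -/

/-- Antitone nonnegative weights: `ω j ≤ ω i` for `i ≤ j` (from the one-step hypothesis). [folklore] -/
theorem weight_antitone {ω : ℕ → ℝ} (hmono : ∀ k, ω (k + 1) ≤ ω k) {i j : ℕ} (hij : i ≤ j) : ω j ≤ ω i := by
  induction hij with
  | refl => exact le_rfl
  | step _ ih => exact (hmono _).trans ih

/-- All admissible weights are at most `1`. [folklore] -/
theorem weight_le_one {ω : ℕ → ℝ} (hmono : ∀ k, ω (k + 1) ≤ ω k) (hle1 : ω 0 ≤ 1) (k : ℕ) : ω k ≤ 1 :=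
  (weight_antitone hmono (Nat.zero_le k)).trans hle1

/-- **One exchange step**: for an admissible (nonnegative, antitone, log-concave) weight and `a + 2 ≤ d`,
`ω a · ω d ≤ ω (a+1) · ω (d−1)`.  Zeros are allowed: antitonicity makes the zero set a tail. [folklore] -/
theorem lc_exchange_step {ω : ℕ → ℝ} (h0 : ∀ k, 0 ≤ ω k) (hmono : ∀ k, ω (k + 1) ≤ ω k)
    (hlc : ∀ k, ω k * ω (k + 2) ≤ ω (k + 1) ^ 2) :
    ∀ n a d : ℕ, d = a + 2 + n → ω a * ω d ≤ ω (a + 1) * ω (d - 1) := by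
  intro n
  induction n with
  | zero =>
    intro a d hd
    subst hd
    simp only [add_zero, show a + 2 - 1 = a + 1 by omega]
    rw [← sq]
    exact hlc a
  | succ n ih =>
    intro a d hd
    -- `d = (a + 2 + n) + 1`; apply the hypothesis to `d' = a + 2 + n` and log-concavity at `d' - 1`
    set d' := a + 2 + n with hd'
    have hdd : d = d' + 1 := by omega
    have ih' := ih a d' rfl                       -- ω a * ω d' ≤ ω (a+1) * ω (d'-1)
    have hlc' : ω (d' - 1) * ω (d' + 1) ≤ ω d' ^ 2 := by
      have h := hlc (d' - 1)
      rwa [show d' - 1 + 2 = d' + 1 by omega, show d' - 1 + 1 = d' by omega] at h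
    rw [hdd, show d' + 1 - 1 = d' by omega]
    -- case split on whether ω d' vanishes
    rcases (h0 d').eq_or_lt with hz | hpos
    · -- ω d' = 0 ⟹ ω (d'+1) = 0
      have h1 : ω (d' + 1) = 0 := le_antisymm (hz ▸ hmono d') (h0 _)
      rw [h1, mul_zero]
      exact mul_nonneg (h0 _) (h0 _)
    · -- ω d' > 0, hence ω (d'-1) > 0
      have hpos' : 0 < ω (d' - 1) := lt_of_lt_of_le hpos (weight_antitone hmono (Nat.sub_le d' 1))
      -- ω a ω (d'+1) ≤ ω a ω d'^2 / ω (d'-1) ≤ ω (a+1) ω d'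
      have step1 : ω a * ω (d' + 1) * ω (d' - 1) ≤ ω a * ω d' ^ 2 := by
        have := mul_le_mul_of_nonneg_left hlc' (h0 a)
        linarith [this]
      have step2 : ω a * ω d' ^ 2 ≤ ω (a + 1) * ω (d' - 1) * ω d' := by
        have := mul_le_mul_of_nonneg_right ih' (h0 d')
        nlinarith [this]
      have : ω a * ω (d' + 1) * ω (d' - 1) ≤ (ω (a + 1) * ω d') * ω (d' - 1) := by
        calc ω a * ω (d' + 1) * ω (d' - 1) ≤ ω a * ω d' ^ 2 := step1
          _ ≤ ω (a + 1) * ω (d' - 1) * ω d' := step2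
          _ = (ω (a + 1) * ω d') * ω (d' - 1) := by ring
      exact le_of_mul_le_mul_right this hpos'

/-- **The log-concave exchange**: `ω a · ω d ≤ ω b · ω c` whenever `a ≤ b ≤ c ≤ d` and `a + d = b + c`
("less spread is larger"), for every nonnegative antitone log-concave weight. [folklore] -/
theorem lc_exchange {ω : ℕ → ℝ} (h0 : ∀ k, 0 ≤ ω k) (hmono : ∀ k, ω (k + 1) ≤ ω k)
    (hlc : ∀ k, ω k * ω (k + 2) ≤ ω (k + 1) ^ 2) :
    ∀ m a b c d : ℕ, b = a + m → a ≤ b → b ≤ c → c ≤ d → a + d = b + c → ω a * ω d ≤ ω b * ω c := by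
  intro m
  induction m with
  | zero =>
    intro a b c d hb _ _ _ hsum
    subst hb
    have hcd : d = c := by omega
    subst hcd
    simp
  | succ m ih =>
    intro a b c d hb _ hbc hcd hsum
    -- one step: (a, d) → (a+1, d-1), then the induction hypothesis from a+1
    have had : a + 2 ≤ d := by omega
    have h1 := lc_exchange_step h0 hmono hlc (d - (a + 2)) a d (by omega)
    have h2 := ih (a + 1) b c (d - 1) (by omega) (by omega) hbc (by omega) (by omega)
    exact h1.trans h2

/-! ## The domination rules -/

/-- **Rule R1**: `ω i · ω j ≤ ω k` whenever `k ≤ max i j` (uses `ω ≤ 1` and antitonicity only). [this work] -/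
theorem mul_le_of_le_max {ω : ℕ → ℝ} (h0 : ∀ k, 0 ≤ ω k) (hmono : ∀ k, ω (k + 1) ≤ ω k) (hle1 : ω 0 ≤ 1)
    {i j k : ℕ} (hk : k ≤ max i j) : ω i * ω j ≤ ω k := by
  rcases le_max_iff.1 hk with hki | hkj
  · calc ω i * ω j ≤ ω i * 1 := mul_le_mul_of_nonneg_left (weight_le_one hmono hle1 j) (h0 i)
      _ = ω i := mul_one _
      _ ≤ ω k := weight_antitone hmono hki
  · calc ω i * ω j ≤ 1 * ω j := mul_le_mul_of_nonneg_right (weight_le_one hmono hle1 i) (h0 j)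
      _ = ω j := one_mul _
      _ ≤ ω k := weight_antitone hmono hkj

/-- **Rule R2**: `ω i · ω j ≤ ω k · ω l` whenever `k ≤ l`, `l ≤ j` and `k + l ≤ i + j`
(the pair `(k,l)` is dominated by `(i,j)`: no larger maximum and no larger sum; `i ≤ j` is not needed). [this work] -/
theorem mul_le_mul_of_dominated {ω : ℕ → ℝ} (h0 : ∀ k, 0 ≤ ω k) (hmono : ∀ k, ω (k + 1) ≤ ω k)
    (hlc : ∀ k, ω k * ω (k + 2) ≤ ω (k + 1) ^ 2)
    {i j k l : ℕ} (hkl : k ≤ l) (hlj : l ≤ j) (hsum : k + l ≤ i + j) :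
    ω i * ω j ≤ ω k * ω l := by
  by_cases hli : l ≤ i
  · -- k ≤ l ≤ i ≤ j: pure antitonicity
    exact mul_le_mul (weight_antitone hmono (hkl.trans hli)) (weight_antitone hmono hlj) (h0 _) (h0 _)
  · push Not at hli
    -- i < l ≤ j; let k' = i + j - l, so i ≤ k' and k ≤ k'
    set k' := i + j - l with hk'
    have hik' : i ≤ k' := by omega
    have hkk' : k ≤ k' := by omega
    by_cases hk'l : k' ≤ l
    · -- a = i ≤ k' ≤ l ≤ j = d
      have hex := lc_exchange h0 hmono hlc (k' - i) i k' l j (by omega) hik' hk'l hlj (by omega)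
      calc ω i * ω j ≤ ω k' * ω l := hex
        _ ≤ ω k * ω l := mul_le_mul_of_nonneg_right (weight_antitone hmono hkk') (h0 l)
    · push Not at hk'l
      -- a = i ≤ l < k' ≤ j = d
      have hk'j : k' ≤ j := by omega
      have hex := lc_exchange h0 hmono hlc (l - i) i l k' j (by omega) hli.le hk'l.le hk'j (by omega)
      calc ω i * ω j ≤ ω l * ω k' := hex
        _ ≤ ω l * ω k := mul_le_mul_of_nonneg_left (weight_antitone hmono hkk') (h0 l)
        _ = ω k * ω l := mul_comm _ _

/-- **Rule R4**: `ω 0 · ω k ≤ ω i · ω j` whenever `i + j ≤ k` (sub-multiplicativity of log-concave antitone weights). [this work] -/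
theorem mul_zero_le_mul_of_add_le {ω : ℕ → ℝ} (h0 : ∀ k, 0 ≤ ω k) (hmono : ∀ k, ω (k + 1) ≤ ω k)
    (hlc : ∀ k, ω k * ω (k + 2) ≤ ω (k + 1) ^ 2) {i j k : ℕ} (hk : i + j ≤ k) :
    ω 0 * ω k ≤ ω i * ω j := by
  wlog hij : i ≤ j generalizing i j
  · rw [mul_comm (ω i)]; exact this (by omega) (le_of_not_ge hij)
  calc ω 0 * ω k ≤ ω 0 * ω (i + j) := mul_le_mul_of_nonneg_left (weight_antitone hmono hk) (h0 0)
    _ ≤ ω i * ω j := lc_exchange h0 hmono hlc i 0 i j (i + j) (by omega) (Nat.zero_le i) hij (by omega) (by omega)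

/-! ## Soundness of a matching certificate -/

/-- **A dominated injection bounds the sum**: if every negative unit `neg s` (`s ∈ S`) is at most the positive unit `pos (φ s)`
of an injection `φ : S → T`, and all positive units are nonnegative, then `Σ_S neg ≤ Σ_T pos`.  This is the arithmetic behind the
memo's matching certificate: the fibre coefficient `Σ_T pos − Σ_S neg` is nonnegative. [folklore] -/
theorem sum_le_sum_of_dominating_injection {σ τ : Type*} [DecidableEq τ] (S : Finset σ) (T : Finset τ)
    (neg : σ → ℝ) (pos : τ → ℝ) (φ : σ → τ) (hφT : ∀ s ∈ S, φ s ∈ T) (hinj : Set.InjOn φ ↑S)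
    (hdom : ∀ s ∈ S, neg s ≤ pos (φ s)) (hpos : ∀ t ∈ T, 0 ≤ pos t) :
    ∑ s ∈ S, neg s ≤ ∑ t ∈ T, pos t := by
  calc ∑ s ∈ S, neg s ≤ ∑ s ∈ S, pos (φ s) := Finset.sum_le_sum hdom
    _ = ∑ t ∈ S.image φ, pos t := (Finset.sum_image hinj).symm
    _ ≤ ∑ t ∈ T, pos t :=
        Finset.sum_le_sum_of_subset_of_nonneg (fun t ht => by
          obtain ⟨s, hs, rfl⟩ := Finset.mem_image.1 ht; exact hφT s hs) (fun t ht _ => hpos t ht)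

end SahiOneStep

end Summit.CriticalPhenomena.PercolationContinuityZ3.Theorems
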